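import Literature.Probability.LatticeModels.HarmonicReflectionBound
import Literature.Probability.LatticeModels.BarrierStepNearSide
import HarnessLib

/-!
# The canonical harmonic lower bound of Duminil-Copin–Hongler–Nolin's Lemma 10: `c/d` below the slit box

Topic `Literature/Probability/LatticeModels`; discrete potential theory for the slit-domain lower bound
of the `fkIsing_rsw` programme (Duminil-Copin–Hongler–Nolin 2011, §3.2, Lemma 10 / Duminil-Copin
2013, Lemma 10.3: "the harmonic measure of the wired arc in the slit domain
`(ℍ ∖ l_k(-k), (-k,k), ∞)`, which has respectively wired and free boundary conditions to the left
and to the right of `(-k, k)` … estimating this harmonic measure is straightforward"). The canonical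
comparison function is the harmonic function `φ = harmExt (slitBoxDomain N H T) slitData` of the
mirror-symmetric slit box of `HarmonicReflectionBound.lean` (data `1` on the closed left half,
`0` on the right half; the two slit columns `X ∈ {0, 1}`, `Y < T` removed). We prove the
quantitative lower bound at the point `(1 + d, 0)` of the bottom row, at lateral distance `d` from the
right slit column, for slits of height `T ≤ d`:

  `slitCanonicalConst / (2d) ≤ φ (1 + d, 0)`,   `slitCanonicalConst = (1/5) · barrierConst · 2e^{-4π}`

(`fifth_barrier_le_harmExt_slitBox`), uniformly in `N ≥ 1 + 4d`, `H ≥ T + 8d`. Proof, as in DCHN's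
sketch: (A) `φ ≥ 1/5` on the column `X = 1` above the slit (`fifth_le_harmExt_slitBox`, reflection
symmetry); (B) the barrier step of `WeakBeurlingEstimate.lean` in the frame whose far side is that
column transports the bound `(1/5)·barrierConst` to the row `Y = T - 1 + 2d`, columns `2 … 2d`;
(C) the near-side barrier step of `BarrierStepNearSide.lean` (gambler's ruin) in the frame whose near
side is the row `Y = -1` brings it down to `(1 + d, 0)` at the price `2e^{-4π}/(2d)`.
Everything is proved; no named fact; [folklore] on top of the cited tree files.

## References

* H. Duminil-Copin, C. Hongler, P. Nolin, Comm. Pure Appl. Math. 64 (2011), §3.2, Lemma 10 — bib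
  key `DuminilCopinHonglerNolin2011`.
* G. Lawler, V. Limic, *Random Walk: A Modern Introduction* (2010), §5.1, §6.2, §8.1 — bib key
  `LawlerLimic2010`.
-/

noncomputable section

namespace Literature.Probability.LatticeModels

open Set Real WeakBeurling

/-- The absolute constant of the canonical bound: `(1/5) · barrierConst · 2e^{-4π}` (so that the
bound at lateral distance `d` reads `slitCanonicalConst / (2d)`). [folklore] -/
def slitCanonicalConst : ℝ := 1 / 5 * barrierConst * (2 * Real.exp (-(4 * π)))

/-- `slitCanonicalConst > 0`. [folklore] -/
theorem slitCanonicalConst_pos : 0 < slitCanonicalConst := by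
  unfold slitCanonicalConst; have := barrierConst_pos; positivity

section

variable {N H T : ℕ}

/-- The harmonic function of the slit box is superharmonic on every subset of the box. [folklore] -/
theorem superharmonicOn_harmExt_slitBox {D : Set (Site 2)} (hD : D ⊆ slitBoxDomain N H T) :
    IsLatticeSuperharmonicOn (harmExt (slitBoxDomain N H T) slitData) D :=
  fun v hv => ((harmExt_harmonicOn slitBoxDomain_finite slitData).superharmonicOn) v (hD hv)

/-- **Step B: from the column above the slit to the row `Y = T - 1 + 2d`.** For `1 ≤ d`,
`1 + 4d ≤ N`, `T + 8d ≤ H`: `(1/5)·barrierConst ≤ φ (x, T - 1 + 2d)` for `2 ≤ x ≤ 2d`. [folklore] -/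
theorem stepB_harmExt_slitBox (hN : 1 ≤ N) {d : ℕ} (hd : 1 ≤ d) (hNd : 1 + 4 * d ≤ N) (hHd : T + 8 * d ≤ H)
    {x : ℤ} (hx2 : 2 ≤ x) (hx : x ≤ 2 * d) :
    1 / 5 * barrierConst ≤ harmExt (slitBoxDomain N H T) slitData ![x, (T : ℤ) - 1 + 2 * d] := by
  set φ := harmExt (slitBoxDomain N H T) slitData with hφ
  -- the frame: `i = 0` (depth = abscissa, towards the slit), `s = -1`, `a = T - 1`, `b = 2 + 4d`; `L = 8d - 1`, `M = 4d`
  set L : ℕ := 8 * d - 1 with hL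
  set M : ℕ := 4 * d with hM
  have hL1 : 1 ≤ L := by omega
  have hLM : M + 1 ≤ 4 * (L + 1) := by omega
  set D : Set (Site 2) := {z | 1 ≤ z 1 - ((T : ℤ) - 1) ∧ z 1 - ((T : ℤ) - 1) ≤ L ∧ 1 ≤ -1 * (z 0 - (2 + 4 * (d : ℤ))) ∧
    -1 * (z 0 - (2 + 4 * (d : ℤ))) ≤ M} with hDdef
  have hDsub : D ⊆ slitBoxDomain N H T := by
    intro z hz
    obtain ⟨h1, h2, h3, h4⟩ := hz
    simp only [slitBoxDomain, Set.mem_setOf_eq]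
    have hL' : (L : ℤ) = 8 * d - 1 := by omega
    have hM' : (M : ℤ) = 4 * d := by omega
    omega
  have hDfin : D.Finite := slitBoxDomain_finite.subset hDsub
  have hframe : ∀ z ∈ D, 1 ≤ z (0 : Fin 2).rev - ((T : ℤ) - 1) ∧ z (0 : Fin 2).rev - ((T : ℤ) - 1) ≤ L ∧
      1 ≤ -1 * (z 0 - (2 + 4 * (d : ℤ))) ∧ -1 * (z 0 - (2 + 4 * (d : ℤ))) ≤ M := fun z hz => hz
  have h0 : ∀ w ∈ latticeOuterBoundary D, 0 ≤ φ w := fun w _ => (harmExt_slitBox_mem w).1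
  have h1 : ∀ w ∈ latticeOuterBoundary D, 1 ≤ w (0 : Fin 2).rev - ((T : ℤ) - 1) → w (0 : Fin 2).rev - ((T : ℤ) - 1) ≤ L →
      1 ≤ -1 * (w 0 - (2 + 4 * (d : ℤ))) → -1 * (w 0 - (2 + 4 * (d : ℤ))) ≤ M + 1 → 1 / 5 ≤ φ w := by
    intro w hw hw1 hw2 hw3 hw4
    have hwD : w ∉ D := hw.1
    -- not in `D` but in the closed rectangle: `w` is on the far side, the column `X = 1`
    have hfar : -1 * (w 0 - (2 + 4 * (d : ℤ))) = M + 1 := by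
      by_contra hne
      exact hwD ⟨hw1, hw2, hw3, by omega⟩
    have hM' : (M : ℤ) = 4 * d := by omega
    have hw0 : w 0 = 1 := by linarith
    change (1 : ℤ) ≤ w 1 - ((T : ℤ) - 1) at hw1
    change w 1 - ((T : ℤ) - 1) ≤ L at hw2
    refine fifth_le_harmExt_slitBox hN hw0 (by omega) ?_
    have hL' : (L : ℤ) = 8 * d - 1 := by omega
    omega
  set z : Site 2 := ![x, (T : ℤ) - 1 + 2 * d] with hz
  have hzD : z ∈ D := by
    simp only [hDdef, Set.mem_setOf_eq, hz]
    simp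
    have hL' : (L : ℤ) = 8 * d - 1 := by omega
    have hM' : (M : ℤ) = 4 * d := by omega
    omega
  have key := barrier_step (0 : Fin 2) (s := -1) (Or.inr rfl) ((T : ℤ) - 1) (2 + 4 * (d : ℤ)) hL1 hLM hDfin hframe
    (superharmonicOn_harmExt_slitBox hDsub) (by norm_num : (0 : ℝ) ≤ 1 / 5) h0 h1 hzD
    (by
      change ((L : ℝ) + 1) / 4 ≤ ((z 1 - ((T : ℤ) - 1) : ℤ) : ℝ)
      have : z 1 - ((T : ℤ) - 1) = 2 * d := by simp [hz]
      rw [this]; push_cast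
      have hL' : (L : ℝ) = 8 * d - 1 := by
        have h : (L : ℤ) = 8 * d - 1 := by omega
        exact_mod_cast h
      rw [hL']; linarith)
    (by
      change ((z 1 - ((T : ℤ) - 1) : ℤ) : ℝ) ≤ 3 * ((L : ℝ) + 1) / 4
      have : z 1 - ((T : ℤ) - 1) = 2 * d := by simp [hz]
      rw [this]; push_cast
      have hL' : (L : ℝ) = 8 * d - 1 := by
        have h : (L : ℤ) = 8 * d - 1 := by omega
        exact_mod_cast h
      rw [hL']
      have : (0 : ℝ) ≤ d := by positivity
      linarith)
    (by
      have : -1 * (z 0 - (2 + 4 * (d : ℤ))) = 2 + 4 * d - x := by simp [hz]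
      rw [this]; push_cast
      have hL' : (L : ℝ) = 8 * d - 1 := by
        have h : (L : ℤ) = 8 * d - 1 := by omega
        exact_mod_cast h
      rw [hL']
      have hx' : (x : ℝ) ≤ 2 * d := by exact_mod_cast hx
      linarith)
  exact key

/-- **The canonical lower bound** (DCHN Lemma 10, quantitative lattice form). For `1 ≤ d`, a slit of
height `T ≤ d`, and a box with `1 + 4d ≤ N`, `T + 8d ≤ H`:
`slitCanonicalConst / (2d) ≤ φ (1 + d, 0)` for the harmonic function `φ` of the slit box. [cite: DuminilCopinHonglerNolin2011, §3.2, Lemma 10] -/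
theorem fifth_barrier_le_harmExt_slitBox (hN : 1 ≤ N) {d : ℕ} (hd : 1 ≤ d) (hTd : T ≤ d) (hNd : 1 + 4 * d ≤ N) (hHd : T + 8 * d ≤ H) :
    slitCanonicalConst / (2 * d) ≤ harmExt (slitBoxDomain N H T) slitData ![1 + (d : ℤ), 0] := by
  set φ := harmExt (slitBoxDomain N H T) slitData with hφ
  -- the frame: `i = 1` (depth = ordinate), `s = 1`, `a = 1`, `b = -1`; `L = 2d - 1`, `M = T - 1 + 2d`
  set L : ℕ := 2 * d - 1 with hL
  set M : ℕ := T + 2 * d - 1 with hM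
  have hL1 : 1 ≤ L := by omega
  have hLM : M + 1 ≤ 4 * (L + 1) := by omega
  set D : Set (Site 2) := {z | 1 ≤ z 0 - 1 ∧ z 0 - 1 ≤ L ∧ 1 ≤ 1 * (z 1 - (-1)) ∧ 1 * (z 1 - (-1)) ≤ M} with hDdef
  have hL' : (L : ℤ) = 2 * d - 1 := by omega
  have hM' : (M : ℤ) = T + 2 * d - 1 := by omega
  have hDsub : D ⊆ slitBoxDomain N H T := by
    intro z hz
    obtain ⟨h1, h2, h3, h4⟩ := hz
    simp only [slitBoxDomain, Set.mem_setOf_eq]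
    omega
  have hDfin : D.Finite := slitBoxDomain_finite.subset hDsub
  have hframe : ∀ z ∈ D, 1 ≤ z (1 : Fin 2).rev - 1 ∧ z (1 : Fin 2).rev - 1 ≤ L ∧ 1 ≤ 1 * (z 1 - (-1)) ∧ 1 * (z 1 - (-1)) ≤ M :=
    fun z hz => hz
  have h0 : ∀ w ∈ latticeOuterBoundary D, 0 ≤ φ w := fun w _ => (harmExt_slitBox_mem w).1
  have h1 : ∀ w ∈ latticeOuterBoundary D, 1 ≤ w (1 : Fin 2).rev - 1 → w (1 : Fin 2).rev - 1 ≤ L →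
      1 ≤ 1 * (w 1 - (-1)) → 1 * (w 1 - (-1)) ≤ M + 1 → 1 / 5 * barrierConst ≤ φ w := by
    intro w hw hw1 hw2 hw3 hw4
    have hwD : w ∉ D := hw.1
    have hfar : 1 * (w 1 - (-1)) = M + 1 := by
      by_contra hne
      exact hwD ⟨hw1, hw2, hw3, by omega⟩
    change (1 : ℤ) ≤ w 0 - 1 at hw1
    change w 0 - 1 ≤ L at hw2
    have hw1' : w 1 = (T : ℤ) - 1 + 2 * d := by omega
    have e : w = ![w 0, (T : ℤ) - 1 + 2 * d] := by funext i; fin_cases i <;> simp [hw1']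
    rw [e]
    exact stepB_harmExt_slitBox hN hd hNd hHd (by omega) (by omega)
  set z : Site 2 := ![1 + (d : ℤ), 0] with hz
  have hzD : z ∈ D := by
    simp only [hDdef, Set.mem_setOf_eq, hz]
    simp
    omega
  have hγ : (0 : ℝ) ≤ 1 / 5 * barrierConst := by have := barrierConst_pos; positivity
  have key := barrier_step_near (1 : Fin 2) (s := 1) (Or.inl rfl) 1 (-1) hL1 hLM hDfin hframe
    (superharmonicOn_harmExt_slitBox hDsub) hγ h0 h1 hzD
    (by
      change ((L : ℝ) + 1) / 4 ≤ ((z 0 - 1 : ℤ) : ℝ)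
      have : z 0 - 1 = d := by simp [hz]
      rw [this]; push_cast
      have hL'' : (L : ℝ) = 2 * d - 1 := by
        have h : (L : ℤ) = 2 * d - 1 := by omega
        exact_mod_cast h
      rw [hL'']; linarith)
    (by
      change ((z 0 - 1 : ℤ) : ℝ) ≤ 3 * ((L : ℝ) + 1) / 4
      have : z 0 - 1 = d := by simp [hz]
      rw [this]; push_cast
      have hL'' : (L : ℝ) = 2 * d - 1 := by
        have h : (L : ℤ) = 2 * d - 1 := by omega
        exact_mod_cast h
      rw [hL'']
      have : (0 : ℝ) ≤ d := by positivity
      linarith)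
  -- `γ · barrierNearConst L = slitCanonicalConst / (L + 1) = slitCanonicalConst / (2d)`
  have hconst : 1 / 5 * barrierConst * barrierNearConst L = slitCanonicalConst / (2 * d) := by
    rw [barrierNearConst, slitCanonicalConst]
    have hL'' : (L : ℝ) + 1 = 2 * d := by
      have h : (L : ℤ) + 1 = 2 * d := by omega
      exact_mod_cast h
    rw [hL'']
    ring
  rw [hconst] at key
  exact key

end

end Literature.Probability.LatticeModels
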